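import Literature.Computability.Cryptography.OracleKickback
import Literature.Computability.QuantumComplexity.OracleCircuitLocality
import Mathlib.Algebra.MvPolynomial.Degrees
import HarnessLib

/-!
# The polynomial method for quantum circuits with oracle gates (Aaronson–Ambainis 2014, Lemma 20)

Beals–Buhrman–Cleve–Mosca–de Wolf's Lemma 4.2 ("the acceptance probability of a `T`-query
network is a real multilinear polynomial of degree `≤ 2T` in the input bits") is in the tree for
the QUERY model `QQueryAlg` (`PolynomialMethod.lean`). Aaronson–Ambainis 2014 use it (as their
Lemma 20) in the proof of Thm. 23 (= Thm. 7 (iii), p. 14) for polynomial-time quantum machines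
querying an ORACLE `A ⊆ {0,1}*`: "`p_x(A) := Pr[Q^A(x) accepts]` … depends only on some finite
prefix `B` of `A` … Lemma 20 implies that `p_x` is a polynomial in the bits of `B`, of degree at
most `poly(n)`." This file proves that statement for the tree's oracle circuits
(`Cryptography/QuantumCircuit.lean`: `QCircuit G N` with `QGate.oracle k e` = the XOR query of `A`
on the strings of length `k` read off the query wires, `QCircuit.toMatrix A`, `acceptProb`,
`QCircuitFamily.acceptProbOn`, the data of `BQPRel A`):

* `OracleVar N = ↥(shortStrings N)` — the oracle bits a circuit on `N` wires can read (the
  strings of length `< N`: an oracle gate with `k` query wires and an answer wire has `k + 1 ≤ N`),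
  in the representation of the topic's random-oracle toolkit (`shortStrings` of
  `OracleCircuitLocality.lean`, the coordinates of `restrictBool`/`IsDetermined` of
  `RandomOracleCylinders.lean`; a `Fintype`); `oraclePt N A` their `0/1` values
  (`oraclePt_eq_restrictBool`);
* `OHasDegreeLE N d a` — the real and imaginary parts of `a : Language Bool → ℂ` are values at
  `oraclePt N A` of real polynomials of total degree `≤ d` in these variables (as `HasDegreeLE` of
  `PolynomialMethod.lean`); closure under constants, sums, constant matrices (`mulVec`) and
  **one oracle gate raises the degree by one** (`OHasDegreeLE.oracleGate`:
  `(U_A ψ)(y) = ψ(oracleTarget_A y) = [q ∈ A] ψ(y^{⊕t}) + (1 - [q ∈ A]) ψ(y)`, `q = queryOf e y`,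
  by `placeGate_oracleGate_mulVec_apply` of `OracleKickback.lean`);
* `ohasDegreeLE_toMatrix_mulVec` — the amplitudes of `U_C^A ψ` have degree `≤ #oracle gates of C`
  (Beals et al. Lemma 4.1 for oracle circuits), `exists_acceptPolynomial_circuit` and
  **`exists_acceptPolynomialOn`** — `A ↦ F.acceptProbOn A x` is (the value of) a real polynomial
  of total degree `≤ 2 · (F.circ |x|).oracleQueries` in the oracle bits of the strings of length
  `< |x| + ancillas |x|` (Lemma 4.2 / Aaronson–Ambainis Lemma 20 for `BQP^A` machines).

Multilinearity is not asserted (only values on oracles matter; cf. `PolynomialMethod.lean`).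
The lemma `length_queryOf_lt` has a copy `FRO.length_queryOf_lt` inside
`FortnowRogersFlipCounting.lean`, which is not imported here (librarian candidate).

## References

* S. Aaronson, A. Ambainis, *The need for structure in quantum speedups*, Theory Comput. 10
  (2014), Lemma 20 and proof of Thm. 23 (arXiv:0911.0996v3, pp. 13–14) [AaronsonAmbainis2014].
* R. Beals, H. Buhrman, R. Cleve, M. Mosca, R. de Wolf, *Quantum lower bounds by polynomials*,
  J. ACM 48 (2001), Lemmas 4.1, 4.2 [BealsEtAl2001].
* M. A. Nielsen, I. L. Chuang, *Quantum Computation and Quantum Information* (2010), §6.1.1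
  Eq. (6.2) (the oracle gate), via `OracleKickback.placeGate_oracleGate_mulVec_apply`.
-/

noncomputable section

namespace Literature.Computability.QuantumComplexity

open Matrix Finset Literature.Computability.Cryptography

variable {G : QGateSet} {N : ℕ}

/-! ### Oracle variables -/

/-- The oracle bits readable by a circuit on `N` wires: the strings of length `< N`, as the
subtype of the topic's `shortStrings N`. [cite: AaronsonAmbainis2014, proof of Thm. 23 ("p_x(A) depends only on some finite prefix B of A")] -/
abbrev OracleVar (N : ℕ) : Type := ↥(shortStrings N)

/-- The `0/1` values of the oracle bits. [cite: BealsEtAl2001, §2 (the input as 0/1 variables)] -/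
def oraclePt (N : ℕ) (A : Language Bool) : OracleVar N → ℝ := fun q => if A.boolIndicator q.1 then 1 else 0

/-- `oraclePt` read through the toolkit's `restrictBool (shortStrings N)`. [folklore] -/
theorem oraclePt_eq_restrictBool (N : ℕ) (A : Language Bool) :
    oraclePt N A = fun u => if restrictBool (shortStrings N) A u then 1 else 0 := by
  funext u
  have h : A.boolIndicator u.1 = restrictBool (shortStrings N) A u := by
    apply Bool.eq_iff_iff.2
    rw [← Set.mem_iff_boolIndicator, restrictBool_eq_true_iff]
  simp only [oraclePt, h]

/-- A query string of an oracle gate placed in an `N`-wire circuit is an oracle variable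
(`k + 1 ≤ N`). [folklore] -/
theorem length_queryOf_lt {k : ℕ} (e : Fin (k + 1) ↪ Fin N) (x : QReg N) : (queryOf e x).length < N := by
  have h := Fintype.card_le_of_embedding e
  simp only [Fintype.card_fin] at h
  simp only [queryOf, List.length_ofFn]
  omega

/-! ### Amplitudes of bounded degree in the oracle bits -/

/-- `a : Language Bool → ℂ` is a complex polynomial of degree `≤ d` in the oracle bits of the
strings of length `< N`: real and imaginary parts are values of real polynomials of total degree
`≤ d`. [cite: BealsEtAl2001, Lemma 4.1] -/
def OHasDegreeLE (N d : ℕ) (a : Language Bool → ℂ) : Prop :=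
  ∃ P Q : MvPolynomial (OracleVar N) ℝ, P.totalDegree ≤ d ∧ Q.totalDegree ≤ d ∧
    ∀ A, a A = (MvPolynomial.eval (oraclePt N A) P : ℂ) +
      (MvPolynomial.eval (oraclePt N A) Q : ℂ) * Complex.I

namespace OHasDegreeLE

variable {d : ℕ}

/-- Constants have degree `≤ d`. [folklore] -/
theorem const (d : ℕ) (c : ℂ) : OHasDegreeLE N d fun _ => c := by
  refine ⟨MvPolynomial.C c.re, MvPolynomial.C c.im, by simp, by simp, fun A => ?_⟩
  simp [Complex.re_add_im]

/-- Weakening the degree bound. [folklore] -/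
theorem mono {d d' : ℕ} (h : d ≤ d') {a : Language Bool → ℂ} (ha : OHasDegreeLE N d a) :
    OHasDegreeLE N d' a := by
  obtain ⟨P, Q, hP, hQ, hPQ⟩ := ha
  exact ⟨P, Q, hP.trans h, hQ.trans h, hPQ⟩

/-- Sums preserve the degree bound. [folklore] -/
theorem add {a b : Language Bool → ℂ} (ha : OHasDegreeLE N d a) (hb : OHasDegreeLE N d b) :
    OHasDegreeLE N d fun A => a A + b A := by
  obtain ⟨P, Q, hP, hQ, h⟩ := ha
  obtain ⟨P', Q', hP', hQ', h'⟩ := hb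
  refine ⟨P + P', Q + Q', (MvPolynomial.totalDegree_add _ _).trans (max_le hP hP'),
    (MvPolynomial.totalDegree_add _ _).trans (max_le hQ hQ'), fun A => ?_⟩
  beta_reduce
  rw [h, h']
  push_cast [map_add]
  ring

/-- Complex scalar multiples preserve the degree bound. [folklore] -/
theorem const_mul (c : ℂ) {a : Language Bool → ℂ} (ha : OHasDegreeLE N d a) :
    OHasDegreeLE N d fun A => c * a A := by
  obtain ⟨P, Q, hP, hQ, h⟩ := ha
  refine ⟨MvPolynomial.C c.re * P - MvPolynomial.C c.im * Q,
    MvPolynomial.C c.re * Q + MvPolynomial.C c.im * P, ?_, ?_, fun A => ?_⟩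
  · exact (MvPolynomial.totalDegree_sub _ _).trans (max_le
      ((MvPolynomial.totalDegree_mul _ _).trans (by simpa using hP))
      ((MvPolynomial.totalDegree_mul _ _).trans (by simpa using hQ)))
  · exact (MvPolynomial.totalDegree_add _ _).trans (max_le
      ((MvPolynomial.totalDegree_mul _ _).trans (by simpa using hQ))
      ((MvPolynomial.totalDegree_mul _ _).trans (by simpa using hP)))
  · beta_reduce
    rw [h]
    conv_lhs => rw [← Complex.re_add_im c]
    push_cast [map_add, map_sub, map_mul, MvPolynomial.eval_C]
    ring_nf
    rw [Complex.I_sq]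
    ring

/-- Finite sums preserve the degree bound. [folklore] -/
theorem sum {ι : Type*} (s : Finset ι) {a : ι → Language Bool → ℂ}
    (ha : ∀ i ∈ s, OHasDegreeLE N d (a i)) : OHasDegreeLE N d fun A => ∑ i ∈ s, a i A := by
  classical
  induction s using Finset.induction_on with
  | empty => simpa using const (N := N) d 0
  | insert i s hi ih =>
    simp only [Finset.sum_insert hi]
    exact add (ha i (Finset.mem_insert_self i s)) (ih fun j hj => ha j (Finset.mem_insert_of_mem hj))

/-- Multiplication by a constant matrix preserves the degree bound (oracle-free gates). [cite: BealsEtAl2001, Lemma 4.1] -/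
theorem mulVec {n : Type*} [Fintype n] (M : Matrix n n ℂ)
    {ψ : Language Bool → n → ℂ} (hψ : ∀ s, OHasDegreeLE N d fun A => ψ A s) (s : n) :
    OHasDegreeLE N d fun A => (M *ᵥ ψ A) s := by
  simp only [Matrix.mulVec, dotProduct]
  exact sum _ fun t _ => const_mul (M s t) (hψ t)

/-- **One oracle gate raises the degree by one**:
`(U_A ψ)(y) = [q ∈ A] · ψ(y with the answer wire flipped) + (1 - [q ∈ A]) · ψ(y)`, `q` the query
string on the query wires of `y`. [cite: BealsEtAl2001, Lemma 4.1] -/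
theorem oracleGate {k : ℕ} (e : Fin (k + 1) ↪ Fin N)
    {ψ : Language Bool → QReg N → ℂ} (hψ : ∀ s, OHasDegreeLE N d fun A => ψ A s) (y : QReg N) :
    OHasDegreeLE N (d + 1) fun A => (placeGate e (Cryptography.oracleGate A k) *ᵥ ψ A) y := by
  set t := e (Fin.last k) with ht
  set y' : QReg N := Function.update y t (!y t) with hy'
  obtain ⟨P, Q, hP, hQ, h⟩ := hψ y
  obtain ⟨P', Q', hP', hQ', h'⟩ := hψ y'
  beta_reduce at h h'
  set v : OracleVar N := ⟨queryOf e y, mem_shortStrings.2 (length_queryOf_lt e y)⟩ with hv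
  have hX : (MvPolynomial.X v : MvPolynomial (OracleVar N) ℝ).totalDegree ≤ 1 := by
    rw [MvPolynomial.totalDegree_X]
  have h1X : (1 - MvPolynomial.X v : MvPolynomial (OracleVar N) ℝ).totalDegree ≤ 1 :=
    (MvPolynomial.totalDegree_sub _ _).trans (max_le (by simp) hX)
  refine ⟨(1 - MvPolynomial.X v) * P + MvPolynomial.X v * P',
    (1 - MvPolynomial.X v) * Q + MvPolynomial.X v * Q', ?_, ?_, fun A => ?_⟩
  · refine (MvPolynomial.totalDegree_add _ _).trans (max_le ?_ ?_) <;>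
      refine (MvPolynomial.totalDegree_mul _ _).trans ?_ <;> omega
  · refine (MvPolynomial.totalDegree_add _ _).trans (max_le ?_ ?_) <;>
      refine (MvPolynomial.totalDegree_mul _ _).trans ?_ <;> omega
  · simp only [placeGate_oracleGate_mulVec_apply]
    have hXv : MvPolynomial.eval (oraclePt N A) (MvPolynomial.X v) =
        if A.boolIndicator (queryOf e y) then 1 else 0 := by
      rw [MvPolynomial.eval_X]; rfl
    unfold oracleTarget
    cases hq : A.boolIndicator (queryOf e y)
    · rw [Bool.xor_false, Function.update_eq_self, h]
      simp [map_add, map_sub, map_mul, hXv, hq]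
    · rw [Bool.xor_true, ← ht, ← hy', h']
      simp [map_add, map_sub, map_mul, hXv, hq]

end OHasDegreeLE

/-! ### Circuits -/

/-- **Beals et al. Lemma 4.1 for oracle circuits**: applying a gate list to a family of states
of degree `≤ d` yields states of degree `≤ d + (number of oracle gates)`. [cite: BealsEtAl2001, Lemma 4.1] -/
theorem ohasDegreeLE_toMatrix_mulVec (gs : List (QGate G N)) {d : ℕ}
    {ψ : Language Bool → QReg N → ℂ} (hψ : ∀ s, OHasDegreeLE N d fun A => ψ A s) (s : QReg N) :
    OHasDegreeLE N (d + (⟨gs⟩ : QCircuit G N).oracleQueries)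
      fun A => ((⟨gs⟩ : QCircuit G N).toMatrix A *ᵥ ψ A) s := by
  induction gs generalizing d ψ s with
  | nil =>
    simp only [QCircuit.toMatrix_nil, Matrix.one_mulVec]
    exact (hψ s).mono (Nat.le_add_right _ _)
  | cons g gs ih =>
    simp only [QCircuit.toMatrix_cons, ← Matrix.mulVec_mulVec]
    cases g with
    | gate g e =>
      have hq : (⟨QGate.gate g e :: gs⟩ : QCircuit G N).oracleQueries = (⟨gs⟩ : QCircuit G N).oracleQueries := by
        simp [QCircuit.oracleQueries, QGate.IsOracleFree]
      rw [hq]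
      exact ih (ψ := fun A => (QGate.gate g e : QGate G N).toMatrix A *ᵥ ψ A)
        (fun s => by simpa using OHasDegreeLE.mulVec (placeGate e (G.mat g)) hψ s) s
    | oracle k e =>
      have hq : (⟨QGate.oracle k e :: gs⟩ : QCircuit G N).oracleQueries =
          (⟨gs⟩ : QCircuit G N).oracleQueries + 1 := by
        simp [QCircuit.oracleQueries, QGate.IsOracleFree]
      rw [hq, ← add_assoc, add_right_comm]
      exact ih (ψ := fun A => (QGate.oracle k e : QGate G N).toMatrix A *ᵥ ψ A)
        (fun s => by simpa using OHasDegreeLE.oracleGate e hψ s) s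

/-- **Lemma 4.2 / Aaronson–Ambainis Lemma 20 for one oracle circuit**: the acceptance
probability of `C` on `|x⟩|0^m⟩` relative to `A` is (the value of) a real polynomial of total
degree `≤ 2 · #oracle gates` in the oracle bits of the strings of length `< n + m`. [cite: AaronsonAmbainis2014, Lemma 20] -/
theorem exists_acceptPolynomial_circuit {n m : ℕ} (C : QCircuit G (n + m)) (x : QReg n) :
    ∃ P : MvPolynomial (OracleVar (n + m)) ℝ, P.totalDegree ≤ 2 * C.oracleQueries ∧
      ∀ A, C.acceptProb A x = MvPolynomial.eval (oraclePt (n + m) A) P := by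
  classical
  have hamp : ∀ y : QReg (n + m), OHasDegreeLE (n + m) C.oracleQueries
      fun A => (C.toMatrix A *ᵥ basisState (padInput x m)) y := by
    intro y
    have h := ohasDegreeLE_toMatrix_mulVec C.gates (d := 0) (ψ := fun _ => basisState (padInput x m))
      (fun s => OHasDegreeLE.const 0 _) y
    simpa using h
  choose P Q hP hQ h using hamp
  beta_reduce at h
  refine ⟨∑ y : QReg (n + m), if hn : 0 < n + m then (if y ⟨0, hn⟩ then P y ^ 2 + Q y ^ 2 else 0) else 0,
    ?_, fun A => ?_⟩
  · refine (MvPolynomial.totalDegree_finsetSum _ _).trans (Finset.sup_le fun y _ => ?_)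
    split_ifs
    · refine (MvPolynomial.totalDegree_add _ _).trans (max_le ?_ ?_)
      · exact (MvPolynomial.totalDegree_pow _ _).trans (by have := hP y; nlinarith)
      · exact (MvPolynomial.totalDegree_pow _ _).trans (by have := hQ y; nlinarith)
    · simp
    · simp
  · unfold QCircuit.acceptProb QCircuit.runOn
    rw [map_sum]
    refine Finset.sum_congr rfl fun y _ => ?_
    split_ifs with hn hy
    · rw [h y A, Complex.sq_norm, Complex.normSq_apply]
      simp
      ring
    · simp
    · simp

/-- **Aaronson–Ambainis 2014, Lemma 20 (Beals et al. Lemma 4.2) for `BQP^A` machines**: for a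
circuit family `F` and an input `x`, the acceptance probability `A ↦ Pr[F^A(x) accepts]` is
(the value of) a real polynomial of total degree `≤ 2 · (F.circ |x|).oracleQueries` in the oracle
bits of the strings of length `< |x| + ancillas |x|` ("`p_x` is a polynomial in the bits of `B`,
of degree at most `poly(n)`" when the family has polynomial size). [cite: AaronsonAmbainis2014, Lemma 20 and proof of Thm. 23 (p. 14)] -/
theorem exists_acceptPolynomialOn (F : QCircuitFamily G) (x : List Bool) :
    ∃ P : MvPolynomial (OracleVar (x.length + F.ancillas x.length)) ℝ,
      P.totalDegree ≤ 2 * (F.circ x.length).oracleQueries ∧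
      ∀ A, F.acceptProbOn A x = MvPolynomial.eval (oraclePt (x.length + F.ancillas x.length) A) P :=
  exists_acceptPolynomial_circuit (F.circ x.length) x.get

/-- The number of oracle queries is at most the size of the circuit (so `poly(n)` for families of
polynomial size). Deliberate dot-notation extension of
`Literature.Computability.Cryptography.QCircuit`. [folklore] -/
theorem _root_.Literature.Computability.Cryptography.QCircuit.oracleQueries_le_size {M : ℕ} (C : QCircuit G M) :
    C.oracleQueries ≤ C.size :=
  List.length_filter_le _ _

end Literature.Computability.QuantumComplexity

end
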